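import Literature.IUT.LogThetaLattice.PacketLogVolumes
import HarnessLib

/-!
# [IUTchIII] Proposition 3.9 (iii): the two typed predicates are SCHEMAS — universal-closure certificates (proofs only)

S. Mochizuki, *Inter-universal Teichmüller theory III*, kurims manuscript (May 2020), §3, Proposition 3.9 "(Log-volumes)"
(iii), p. 117 [claim: Mochizuki2012, status: disputed] (D-0012 claim key; the content proved here is elementary). abc-iut
cell, block F (seat abc-iut-f-130 gen 7; director-abc g4 row supply `ROWS-LF-0348.tsv` «decide the label»); frozen
FACT-LIST rows **F-2115** `Prop39iii_degree` and **F-2116** `Prop39iii_invariance` (abc-iut-L6-t4, `PacketLogVolumes.lean`),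
node **IUTchIII:Prop3.9(iii)**. PROOF-ONLY (no `def`, no `instance`; nothing of the statement file is re-typed); pattern of
abc-iut-w5-d230's `GlobalPacketsLGPProp33iiSchemaClosures.lean`.

Both predicates are typed over ABSTRACT data — a free family of local log-volume functions `μlog : ∀ v_ℚ, Region v_ℚ → ℝ`
together with a free action `act` (invariance clause) resp. free `regionOf`/`deg` (degree clause). Hence their universal
closures are FALSE, and the rows are consumable only in INSTANCE FORM at genuine carriers, where the tree holds the
theorems (`prop39iii_invariance_packetModel`, `prop39iii_degree_packetModel` — abc-iut-w4-d009,
`PacketLogVolumesPrincipalPackets.lean`; the Haar-model family `prop39iii_*_haarModel*`). The refutations below fill the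
free slots degenerately over a one-place, two-region toy (`Region := Bool`, `μlog(b) = 𝟙_{b = true}`):

* F-2116 — `not_forall_prop39iii_invariance`: the CONSTANT action onto the region of log-volume `1` does not preserve the
  log-volume `0` of the other region; `exists_prop39iii_invariance`: the identity action does.
* F-2115 — `not_forall_prop39iii_degree`: with `regionOf ≡` the volume-`0` region and `deg ≡ 1` no POSITIVE normalisation
  constant `c` gives `0 = c·1`; `exists_prop39iii_degree`: `deg := globalLogVolume ∘ regionOf`, `c = 1`.

HONEST FRAMING: a refuted universal closure is a statement about OUR typing (the predicates admit degenerate arguments),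
not about the printed proposition, which concerns the log-volumes and the product formula of the number field `F_mod` at
the genuine tensor packets — where the cited instance-form theorems apply. Nothing here bears on [IUTchIII] Cor. 3.12 or
takes a side on any author; typed ≠ proved; nothing asserts abc proved or refuted.
-/

noncomputable section

namespace Literature.IUT.LogThetaLattice

/-- The toy local log-volume: one place (`Unit`), two regions (`Bool`), `μlog(true) = 1`, `μlog(false) = 0`; its global
regions are all of `Unit → Bool` (finite support is automatic). Values of the global log-volume at the two constant
regions. [folklore] -/
private theorem globalLogVolume_toy (b : Bool) :
    globalLogVolume (fun (_ : Unit) (c : Bool) => if c then (1 : ℝ) else 0)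
        ⟨fun _ => b, Set.toFinite _⟩ = if b then (1 : ℝ) else 0 := by
  unfold globalLogVolume
  rw [finsum_eq_sum_of_fintype, Fintype.sum_unique]

/-! ## F-2116 `Prop39iii_invariance` ([IUTchIII] Prop 3.9 (iii), product-formula clause) -/

/-- **F-2116 is a schema**: the universal closure of `Prop39iii_invariance` (over all place sets, region types, local
log-volumes and actions) is FALSE — at the toy log-volume the constant action onto the volume-`1` region moves the
volume-`0` region. Instance form of record: `prop39iii_invariance_packetModel`.
[claim: Mochizuki2012, status: disputed] (IUTchIII §3 Prop 3.9 (iii), kurims p.117) -/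
theorem not_forall_prop39iii_invariance :
    ¬ ∀ (VQ : Type) (Region : VQ → Type) (F : Type) (μlog : ∀ vQ, Region vQ → ℝ)
        (act : F → GlobalRegion μlog → GlobalRegion μlog), Prop39iii_invariance μlog act := by
  intro h
  have h1 := h Unit (fun _ => Bool) Unit (fun _ c => if c then (1 : ℝ) else 0)
    (fun _ _ => ⟨fun _ => true, Set.toFinite _⟩) () ⟨fun _ => false, Set.toFinite _⟩
  rw [globalLogVolume_toy, globalLogVolume_toy] at h1
  norm_num at h1

/-- **F-2116, INHABITED**: the identity action preserves every global log-volume (at the toy data; any data would do).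
[claim: Mochizuki2012, status: disputed] (IUTchIII §3 Prop 3.9 (iii), kurims p.117) -/
theorem exists_prop39iii_invariance :
    ∃ (VQ : Type) (Region : VQ → Type) (F : Type) (μlog : ∀ vQ, Region vQ → ℝ)
        (act : F → GlobalRegion μlog → GlobalRegion μlog), Prop39iii_invariance μlog act :=
  ⟨Unit, fun _ => Bool, Unit, fun _ c => if c then (1 : ℝ) else 0, fun _ S => S, fun _ _ => rfl⟩

/-! ## F-2115 `Prop39iii_degree` ([IUTchIII] Prop 3.9 (iii), degree clause) -/

/-- **F-2115 is a schema**: the universal closure of `Prop39iii_degree` (over all objects, local log-volumes, region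
assignments and degree functions) is FALSE — with `regionOf ≡` the volume-`0` toy region and `deg ≡ 1`, `0 = c · 1` forces
`c = 0`, contradicting `0 < c`. Instance form of record: `prop39iii_degree_packetModel`.
[claim: Mochizuki2012, status: disputed] (IUTchIII §3 Prop 3.9 (iii), kurims p.117) -/
theorem not_forall_prop39iii_degree :
    ¬ ∀ (VQ : Type) (Region : VQ → Type) (Obj : Type) (μlog : ∀ vQ, Region vQ → ℝ)
        (regionOf : Obj → GlobalRegion μlog) (deg : Obj → ℝ), Prop39iii_degree μlog regionOf deg := by
  intro h
  obtain ⟨c, hc, hJ⟩ := h Unit (fun _ => Bool) Unit (fun _ c => if c then (1 : ℝ) else 0)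
    (fun _ => ⟨fun _ => false, Set.toFinite _⟩) (fun _ => 1)
  have h1 := hJ ()
  rw [globalLogVolume_toy] at h1
  norm_num at h1
  exact hc.ne' h1.symm

/-- **F-2115, INHABITED**: with `deg := globalLogVolume ∘ regionOf` the degree clause holds with normalisation `c = 1`.
[claim: Mochizuki2012, status: disputed] (IUTchIII §3 Prop 3.9 (iii), kurims p.117) -/
theorem exists_prop39iii_degree :
    ∃ (VQ : Type) (Region : VQ → Type) (Obj : Type) (μlog : ∀ vQ, Region vQ → ℝ)
        (regionOf : Obj → GlobalRegion μlog) (deg : Obj → ℝ), Prop39iii_degree μlog regionOf deg :=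
  ⟨Unit, fun _ => Bool, Unit, fun _ c => if c then (1 : ℝ) else 0, fun _ => ⟨fun _ => true, Set.toFinite _⟩,
    fun _ => globalLogVolume (fun (_ : Unit) (c : Bool) => if c then (1 : ℝ) else 0) ⟨fun _ => true, Set.toFinite _⟩,
    1, one_pos, fun _ => (one_mul _).symm⟩

end Literature.IUT.LogThetaLattice

end
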